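import Literature.Probability.RandomPlanarGeometry.SAWPulledLargeForceExpansionZd
import Literature.Probability.RandomPlanarGeometry.BDGS2012CountMonoExt
import HarnessLib

/-!
# The large-force expansion on `ℤ^{d+1}` has a radius of convergence LINEAR in `1/d`:
# the cost census bound `N_{c,n} ≤ 2ⁿ(2d+1)^c`, coefficient growth `|c_k^{(d)}| ≤ 3^{k+1}(320(2d+1))^k`,
# the pulled Kesten relation for every `y > 4(2d+1)`, and convergence for every `y ≥ 8000(2d+1)`

Topic `Literature/Probability/RandomPlanarGeometry` (continues `SAWPulledLargeForceExpansionZd.lean`: the cost grading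
`costZd`, `costCoeffZd d c n = N_{c,n}` = the number of irreducible bridges of `ℤ^{d+1}` of length `n` and cost `c`
(cost = length − span), the integer coefficients `largeForceCoeffZd d k = c_k^{(d)}` of the large-force expansion
`e^{λ_B(y)} = Σ_k c_k^{(d)} y^{1-k}` of the pulled-bridge free energy `λ_B = pulledBridgeFreeEnergy (d+1)`, the generic
engine `CostSeries.abs_e_le` / `CostSeries.hasSum_e_inv`, and the plain-envelope renewal gap `pulledGap_zd` for `y > μ³`;
`BDGS2012CountMonoExt.lean`: `unitSteps`, `nbrs`, `freeNbrs`, `extendTo`, `restrictTo` and the one-step extension of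
self-avoiding walks).

The previous file proves convergence of the expansion for `y ≥ 1/t*_d` with `t*_d = min (1/(μ³+1)) (1/(400·2κ²·(2κ+1)))`,
`κ = 2d + 2`, i.e. a radius of convergence in `t = 1/y` of order `d^{-3}`, because it feeds the generic engine with the crude
census bound `Σ_n N_{c,n} ≤ 2κ(2κ²)^c` (`N_{c,n} ≤ c_n ≤ κⁿ`, `n ≤ 2c + 1`) and the renewal gap with the envelope
`p_i(y) ≤ y^{2/3}(y^{1/3}μ/y)^i`, geometric only for `y > μ³`.  Both inputs are improved here to their correct order in `d`
by ONE counting remark: a step of a walk on `ℤ^{d+1}` changes `(time) − (force coordinate)` by `0` (the step `+e₀`, one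
choice), by `1` (a lateral step, `2d` choices) or by `2` (the step `−e₀`, one choice), so that for every `x ≥ 0`

  `Σ_{ω ∈ SAW_n(ℤ^{d+1})} x^{n − ω(n)·e₀} ≤ (1 + 2d·x + x²)ⁿ`            (`sum_saws_pow_deficit_le`)

(induction on `n` over the one-step extensions of `BDGS2012CountMonoExt`).  Since the cost of a bridge is exactly
`n − ω(n)·e₀`, this gives `N_{c,n}·x^c ≤ (1 + 2dx + x²)ⁿ` and, at `x = 1/(2d+1)`,

* ★ `costCoeffZd_le_two_pow_mul : N_{c,n}(ℤ^{d+1}) ≤ 2ⁿ · (2d+1)^c` for all `d, c, n`, hence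
  `sum_costCoeffZd_le_linear : Σ_{n<2c+2} N_{c,n} ≤ 4·(4(2d+1))^c`;
* ★★ `abs_largeForceCoeffZd_le_linear : |c_k^{(d)}| ≤ 3^{k+1}·(320(2d+1))^k` for ALL `k` and `d` — the large-force
  coefficients grow at most geometrically with a ratio LINEAR in `d` (their true size is `(2d)^{k-1}(1 + O_k(1/d))`:
  `SAWPulledLargeForceExpansionZdMonic`);
* ★★ `pulledBlockLaw_le_geometric_linear` / `pulledGap_linear`: for `y ≥ 2d + 1` the block law of the pulled renewal
  structure satisfies `p_i(y) ≤ √(y/(2d+1)) · (2√((2d+1)/y))^i` (from `3·span ≤ i + 2` for irreducible bridges, i.e.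
  `2·cost ≥ i − 1`), hence for every `y > 4(2d+1)` the pulled Kesten relation `Σ_i Λ_i(y)e^{-iλ_B(y)} = 1`, a finite
  mean block length, the all-`n` sandwich and the renewal limit hold on `ℤ^{d+1}` (the tree had this for `y > μ³` only);
  `hasSum_costPoly_linear`: Kesten's equation in the expansion variables for `y > 4(2d+1)`;
* ★★★ **`hasSum_largeForceCoeffZd_linear (d) (hy : 8000(2d+1) ≤ y)`: `e^{λ_B(y)} = Σ_k c_k^{(d)} y^{1-k}` on `ℤ^{d+1}`**
  — the large-force expansion converges for every pulling force `y ≥ 8000(2d+1)`, in every dimension: its radius of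
  convergence in `1/y` is at least `1/(8000(2d+1))`, LINEAR in `1/d`; with the explicit uniform remainder
  `abs_exp_pulledBridgeFreeEnergy_sub_sum_le_linear : |e^{λ_B(y)} − Σ_{k≤K} c_k^{(d)} y^{1-k}| ≤ 4y·(960(2d+1)/y)^{K+1}`.

Printed status: Janse van Rensburg–Whittington (2013, §3.2 Theorem 8) give the first-order expansion on `ℤ^d`; explicit
radii / coefficient bounds uniform in the dimension are, to our knowledge, not in print.  Provenance: lane «pcv-sawmu»,
a-p3 g26 (2026-08-28).  PURE STD (standard axioms), no census data, no `decide`.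
-/

noncomputable section

open Finset Filter Topology
open scoped BigOperators
open Literature.Probability.LatticeModels
open Literature.Probability.RandomPlanarGeometry.SAW

namespace Literature.Probability.RandomPlanarGeometry.SAW.Zd

/-! ### One step changes `time − force coordinate` by `0`, `1` (in `2d` ways) or `2` -/

/-- After `n` steps from the origin the force coordinate is at most `n`. [cite: MadrasSlade1993, §1.1] -/
private theorem apply_zero_le_of_mem_saws {d n : ℕ} {ω : ℕ → Site (d + 1)} (hω : ω ∈ saws (d + 1) n) :
    ω n 0 ≤ n := by
  obtain ⟨h0, -, hadj, -⟩ := mem_saws.1 hω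
  exact (abs_le.1 (abs_apply_le_of_adj h0 hadj n le_rfl 0)).2

/-- The force coordinate of a unit step of `ℤ^{d+1}` is `1`, `0` or `−1`; in particular it is `≤ 1`. [cite: MadrasSlade1993, §1.1] -/
private theorem apply_zero_le_one_of_mem_unitSteps {d : ℕ} {v : Site (d + 1)} (hv : v ∈ unitSteps (d + 1)) : v 0 ≤ 1 := by
  obtain ⟨k, rfl | rfl⟩ := mem_unitSteps.1 hv
  · by_cases hk : (0 : Fin (d + 1)) = k
    · subst hk; simp
    · simp [Pi.single_eq_of_ne hk]
  · by_cases hk : (0 : Fin (d + 1)) = k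
    · subst hk; simp
    · simp [Pi.single_eq_of_ne hk]

/-- **The one-step weight sum**: `Σ_{v ∈ unitSteps(ℤ^{d+1})} x^{1 − v·e₀} = 1 + 2d·x + x²` (the step `+e₀` costs `0`, each of the
`2d` lateral steps costs `1`, the step `−e₀` costs `2`). [cite: MadrasSlade1993, §1.1] -/
theorem sum_unitSteps_pow_eq (d : ℕ) (x : ℝ) :
    ∑ v ∈ unitSteps (d + 1), x ^ ((1 : ℤ) - v 0).toNat = 1 + 2 * d * x + x ^ 2 := by
  classical
  rw [unitSteps, Finset.sum_image]
  · rw [Fintype.sum_prod_type, Fin.sum_univ_succ]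
    have h2 : Int.toNat 2 = 2 := rfl
    have hzero : (∑ b : Bool, x ^ ((1 : ℤ) - (if b then (Pi.single (0 : Fin (d + 1)) (1 : ℤ) : Site (d + 1))
        else -(Pi.single (0 : Fin (d + 1)) (1 : ℤ) : Site (d + 1))) 0).toNat) = 1 + x ^ 2 := by
      simp [h2]
    have hsucc : ∀ j : Fin d, (∑ b : Bool, x ^ ((1 : ℤ) - (if b then (Pi.single (Fin.succ j) (1 : ℤ) : Site (d + 1))
        else -(Pi.single (Fin.succ j) (1 : ℤ) : Site (d + 1))) 0).toNat) = x + x := by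
      intro j; simp
    rw [hzero, Finset.sum_congr rfl fun j _ => hsucc j, Finset.sum_const, Finset.card_univ, Fintype.card_fin,
      nsmul_eq_mul]
    ring
  · rintro ⟨k, b⟩ - ⟨k', b'⟩ - h
    have hk : k = k' := by
      by_contra hne
      have := congrFun h k
      cases b <;> cases b' <;> simp [Pi.single_eq_of_ne hne] at this
    subst hk
    cases b <;> cases b' <;> first | rfl | (exfalso; have := congrFun h k; simp at this)

/-- The weight sum over ALL lattice neighbours of the endpoint of an `n`-step self-avoiding walk `ω`:
`Σ_{y ~ ω(n)} x^{(n+1) − y·e₀} = x^{n − ω(n)·e₀} · (1 + 2d·x + x²)`. [cite: MadrasSlade1993, §1.1, eq. (1.1.1)] -/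
theorem sum_nbrs_pow_eq {d n : ℕ} {ω : ℕ → Site (d + 1)} (hω : ω ∈ saws (d + 1) n) (x : ℝ) :
    ∑ y ∈ nbrs (ω n), x ^ (((n + 1 : ℕ) : ℤ) - y 0).toNat = x ^ ((n : ℤ) - ω n 0).toNat * (1 + 2 * d * x + x ^ 2) := by
  classical
  rw [nbrs, Finset.sum_image (add_right_injective (ω n)).injOn, ← sum_unitSteps_pow_eq, Finset.mul_sum]
  refine Finset.sum_congr rfl fun v hv => ?_
  have hωn : ω n 0 ≤ n := apply_zero_le_of_mem_saws hω
  have hv1 : v 0 ≤ 1 := apply_zero_le_one_of_mem_unitSteps hv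
  rw [← pow_add]
  congr 1
  have h : (((n + 1 : ℕ) : ℤ)) - (ω n + v) 0 = ((n : ℤ) - ω n 0) + (1 - v 0) := by push_cast [Pi.add_apply]; ring
  rw [h, Int.toNat_add (by omega) (by omega)]

/-- The sum of any weight over the `(n+1)`-step self-avoiding walks is the sum, over the `n`-step walks `ω` and their free
extensions `y`, of the weight of `ω` extended by `y`. [cite: MadrasSlade1993, §1.1, eq. (1.1.1)] -/
theorem sum_saws_succ_eq_sum_freeNbrs {d n : ℕ} (f : (ℕ → Site (d + 1)) → ℝ) :
    ∑ q ∈ saws (d + 1) (n + 1), f q = ∑ ω ∈ saws (d + 1) n, ∑ y ∈ freeNbrs ω n, f (extendTo ω n y) := by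
  classical
  rw [← Finset.sum_fiberwise_of_maps_to (g := fun q => restrictTo q n) (t := saws (d + 1) n)
      (fun q hq => restrictTo_mem_saws hq)]
  refine Finset.sum_congr rfl fun ω hω => ?_
  have himg : ((saws (d + 1) (n + 1)).filter fun q => restrictTo q n = ω) = (freeNbrs ω n).image (extendTo ω n) := by
    ext q
    simp only [Finset.mem_filter, Finset.mem_image]
    constructor
    · rintro ⟨hq, hres⟩
      refine ⟨q (n + 1), ?_, ?_⟩
      · have := apply_succ_mem_freeNbrs hq
        rwa [hres] at this
      · rw [← hres, extendTo_restrictTo hq]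
    · rintro ⟨y, hy, rfl⟩
      exact ⟨extendTo_mem_saws hω hy, restrictTo_extendTo hω y⟩
  rw [himg, Finset.sum_image]
  intro y₁ _ y₂ _ h
  have := congrFun h (n + 1)
  rwa [extendTo_of_lt (Nat.lt_succ_self n), extendTo_of_lt (Nat.lt_succ_self n)] at this

/-- ★ **The deficit generating inequality**: for every `x ≥ 0` and every `n`,
`Σ_{ω ∈ SAW_n(ℤ^{d+1})} x^{n − ω(n)·e₀} ≤ (1 + 2d·x + x²)ⁿ` — each step raises `time − force coordinate` by `0`, `1` or `2`,
in `1`, `2d`, `1` ways, and self-avoidance only removes terms. [cite: MadrasSlade1993, §1.1, eq. (1.1.1)] -/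
theorem sum_saws_pow_deficit_le (d : ℕ) {x : ℝ} (hx : 0 ≤ x) :
    ∀ n : ℕ, ∑ ω ∈ saws (d + 1) n, x ^ ((n : ℤ) - ω n 0).toNat ≤ (1 + 2 * d * x + x ^ 2) ^ n
  | 0 => by
    rw [pow_zero, Finset.sum_congr rfl fun ω hω => by rw [(mem_saws.1 hω).1], Finset.sum_const, card_saws, count_zero]
    simp
  | n + 1 => by
    classical
    have hP : 0 ≤ 1 + 2 * (d : ℝ) * x + x ^ 2 := by positivity
    rw [sum_saws_succ_eq_sum_freeNbrs]
    calc ∑ ω ∈ saws (d + 1) n, ∑ y ∈ freeNbrs ω n, x ^ (((n + 1 : ℕ) : ℤ) - extendTo ω n y (n + 1) 0).toNat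
        ≤ ∑ ω ∈ saws (d + 1) n, x ^ ((n : ℤ) - ω n 0).toNat * (1 + 2 * d * x + x ^ 2) := by
          refine Finset.sum_le_sum fun ω hω => ?_
          rw [← sum_nbrs_pow_eq hω x]
          simp only [extendTo_of_lt (Nat.lt_succ_self n)]
          exact Finset.sum_le_sum_of_subset_of_nonneg (Finset.filter_subset _ _) fun y _ _ => by positivity
      _ = (∑ ω ∈ saws (d + 1) n, x ^ ((n : ℤ) - ω n 0).toNat) * (1 + 2 * d * x + x ^ 2) := by rw [Finset.sum_mul]
      _ ≤ (1 + 2 * d * x + x ^ 2) ^ n * (1 + 2 * d * x + x ^ 2) :=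
          mul_le_mul_of_nonneg_right (sum_saws_pow_deficit_le d hx n) hP
      _ = (1 + 2 * d * x + x ^ 2) ^ (n + 1) := (pow_succ _ _).symm

/-! ### The cost census bound `N_{c,n} ≤ 2ⁿ(2d+1)^c` and the coefficient bound -/

/-- For an irreducible bridge the cost `n − span` is the deficit `n − ω(n)·e₀` (the force coordinate is the span, `≥ 0`).
[cite: MadrasSlade1993, §4.2, eq. (4.2.20)–(4.2.22) (p. 94, 2013 reprint)] -/
theorem costZd_eq_toNat_sub {d n : ℕ} {ω : ℕ → Site (d + 1)} (hω : ω ∈ irreducibleBridges (d + 1) n) :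
    costZd d n ω = ((n : ℤ) - ω n 0).toNat := by
  obtain ⟨hb, hn1, -, -⟩ := mem_irreducibleBridges.1 hω
  obtain ⟨hs, hbr⟩ := mem_bridges.1 hb
  have h0 : 0 < ω n 0 := by
    have := (hbr n hn1 le_rfl).1
    rwa [(mem_saws.1 hs).1, Pi.zero_apply] at this
  have hle := (span_le_and_cost_bound_zd hω).1
  unfold costZd
  omega

/-- `N_{c,n} · x^c ≤ (1 + 2d·x + x²)ⁿ` for every `x ≥ 0`. [cite: MadrasSlade1993, §4.2, eq. (4.2.20)–(4.2.22) (p. 94, 2013 reprint)] -/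
theorem costCoeffZd_mul_pow_le (d c n : ℕ) {x : ℝ} (hx : 0 ≤ x) :
    (costCoeffZd d c n : ℝ) * x ^ c ≤ (1 + 2 * d * x + x ^ 2) ^ n := by
  classical
  have hsub : ((irreducibleBridges (d + 1) n).filter fun ω => costZd d n ω = c) ⊆ saws (d + 1) n := fun ω hω =>
    (mem_bridges.1 (mem_irreducibleBridges.1 (Finset.mem_filter.1 hω).1).1).1
  have h1 : (costCoeffZd d c n : ℝ) * x ^ c =
      ∑ ω ∈ (irreducibleBridges (d + 1) n).filter (fun ω => costZd d n ω = c), x ^ ((n : ℤ) - ω n 0).toNat := by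
    rw [Finset.sum_congr rfl fun ω hω => by
      rw [← costZd_eq_toNat_sub (Finset.mem_filter.1 hω).1, (Finset.mem_filter.1 hω).2], Finset.sum_const, nsmul_eq_mul]
    unfold costCoeffZd
    congr
  rw [h1]
  exact (Finset.sum_le_sum_of_subset_of_nonneg hsub fun ω _ _ => by positivity).trans (sum_saws_pow_deficit_le d hx n)

/-- At `x = 1/(2d+1)`: `1 + 2d/(2d+1) + 1/(2d+1)² ≤ 2`. [folklore] -/
private theorem one_add_poly_at_inv_le_two (d : ℕ) :
    (1 + 2 * (d : ℝ) * (1 / (2 * d + 1)) + (1 / (2 * d + 1)) ^ 2) ≤ 2 := by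
  have hD : (0 : ℝ) < 2 * d + 1 := by positivity
  have h1 : 2 * (d : ℝ) * (1 / (2 * d + 1)) + (1 / (2 * d + 1)) ^ 2 ≤ 1 := by
    rw [div_pow, one_pow, mul_one_div, div_add_div _ _ hD.ne' (pow_ne_zero 2 hD.ne'), div_le_one (by positivity)]
    have : (2 * d + 1 : ℝ) * (2 * d + 1) ^ 2 - (2 * d * (2 * d + 1) ^ 2 + (2 * d + 1) * 1) = 2 * d * (2 * d + 1) := by ring
    nlinarith [this, show (0 : ℝ) ≤ 2 * d * (2 * d + 1) by positivity]
  linarith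

/-- ★ **THE COST CENSUS BOUND**: `N_{c,n}(ℤ^{d+1}) ≤ 2ⁿ · (2d+1)^c` for all `d, c, n` (`x = 1/(2d+1)`:
`1 + 2d/(2d+1) + 1/(2d+1)² ≤ 2`). [cite: MadrasSlade1993, §4.2, eq. (4.2.20)–(4.2.22) (p. 94, 2013 reprint)] -/
theorem costCoeffZd_le_two_pow_mul (d c n : ℕ) : costCoeffZd d c n ≤ 2 ^ n * (2 * d + 1) ^ c := by
  have hD : (0 : ℝ) < 2 * d + 1 := by positivity
  have h := costCoeffZd_mul_pow_le d c n (x := 1 / (2 * d + 1)) (by positivity)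
  have hP := one_add_poly_at_inv_le_two d
  have h2 : (costCoeffZd d c n : ℝ) * (1 / (2 * d + 1)) ^ c ≤ 2 ^ n :=
    h.trans (pow_le_pow_left₀ (by positivity) hP n)
  rw [div_pow, one_pow, mul_one_div, div_le_iff₀ (by positivity)] at h2
  exact_mod_cast h2

/-- `Σ_{n<2c+2} N_{c,n}(ℤ^{d+1}) ≤ 4·(4(2d+1))^c` — the census hypothesis of the generic engine with `B = 4`, `ρ = 4(2d+1)`.
[cite: JansevanRensburgWhittington2013, §3.2 Theorem 8 (arXiv v4 p. 11)] -/
theorem sum_costCoeffZd_le_linear (d c : ℕ) :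
    (∑ n ∈ Finset.range (2 * c + 2), (costCoeffZd d c n : ℝ)) ≤ 4 * (4 * (2 * d + 1)) ^ c := by
  calc (∑ n ∈ Finset.range (2 * c + 2), (costCoeffZd d c n : ℝ))
      ≤ ∑ n ∈ Finset.range (2 * c + 2), (2 : ℝ) ^ n * (2 * d + 1) ^ c :=
        Finset.sum_le_sum fun n _ => by exact_mod_cast costCoeffZd_le_two_pow_mul d c n
    _ = (∑ n ∈ Finset.range (2 * c + 2), (2 : ℝ) ^ n) * (2 * d + 1) ^ c := by rw [Finset.sum_mul]
    _ ≤ 2 ^ (2 * c + 2) * (2 * d + 1) ^ c := by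
        refine mul_le_mul_of_nonneg_right ?_ (by positivity)
        rw [geom_sum_eq (by norm_num : (2 : ℝ) ≠ 1)]
        norm_num
    _ = 4 * (4 * (2 * d + 1)) ^ c := by rw [pow_add, pow_mul, mul_pow]; norm_num; ring

/-- ★★ **GEOMETRIC GROWTH OF THE LARGE-FORCE COEFFICIENTS, LINEAR IN `d`**: `|c_k^{(d)}| ≤ 3^{k+1}·(320(2d+1))^k` for ALL
`k` and `d` (the generic `CostSeries.abs_e_le` with `B = 4`, `ρ = 4(2d+1)`).
[cite: JansevanRensburgWhittington2013, §3.2 Theorem 8 (arXiv v4 p. 11)] -/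
theorem abs_largeForceCoeffZd_le_linear (d k : ℕ) :
    |((largeForceCoeffZd d k : ℤ) : ℝ)| ≤ 3 ^ (k + 1) * (320 * (2 * d + 1)) ^ k := by
  have h := CostSeries.abs_e_le (costCoeffZd d) (B := 4) (ρ := 4 * (2 * d + 1)) (by norm_num) (by positivity)
    (sum_costCoeffZd_le_linear d) k
  have hc : (16 : ℝ) * (4 * (2 * d + 1)) * (4 + 1) = 320 * (2 * d + 1) := by ring
  rw [hc] at h
  exact h

/-- The same with one constant: `|c_k^{(d)}| ≤ 3·(960(2d+1))^k`. [cite: JansevanRensburgWhittington2013, §3.2 Theorem 8 (arXiv v4 p. 11)] -/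
theorem abs_largeForceCoeffZd_le_linear' (d k : ℕ) :
    |((largeForceCoeffZd d k : ℤ) : ℝ)| ≤ 3 * (960 * (2 * d + 1)) ^ k := by
  have h := abs_largeForceCoeffZd_le_linear d k
  have hA : (960 : ℝ) * (2 * d + 1) = 3 * (320 * (2 * d + 1)) := by ring
  rw [hA, mul_pow, ← mul_assoc, ← pow_succ']
  exact h

/-! ### The renewal gap for `y > 4(2d+1)` -/

/-- **Linear envelope of the irreducible-bridge generating function**: for `y ≥ 2d + 1` and `i ≥ 1`,
`Λ_i(y) ≤ yⁱ · √((2d+1)/y)^{i-1} · 2ⁱ` (`y^{span} = yⁱ·(1/y)^{cost}`, `(1/y)^{cost} = q^{cost}(2d+1)^{-cost}` with `q = (2d+1)/y ≤ 1`,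
`q^{cost} ≤ √q^{i-1}` because `2·cost ≥ i − 1` for irreducible bridges, and `Σ_ω (2d+1)^{-cost(ω)} ≤ 2ⁱ`).
[cite: MadrasSlade1993, §4.2, eq. (4.2.21)–(4.2.22) (p. 94, 2013 reprint)] -/
theorem pulledIrrZ_le_linear (d : ℕ) {i : ℕ} (hi : 1 ≤ i) {y : ℝ} (hy : (2 * d + 1 : ℝ) ≤ y) :
    pulledIrrZ (d + 1) i y ≤ y ^ i * Real.sqrt ((2 * d + 1) / y) ^ (i - 1) * 2 ^ i := by
  classical
  have hD : (0 : ℝ) < 2 * d + 1 := by positivity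
  have hy0 : 0 < y := hD.trans_le hy
  set q : ℝ := (2 * d + 1) / y with hq
  have hq0 : 0 ≤ q := by positivity
  have hq1 : q ≤ 1 := (div_le_one hy0).2 hy
  have hs0 : 0 ≤ Real.sqrt q := Real.sqrt_nonneg q
  have hs1 : Real.sqrt q ≤ 1 := Real.sqrt_le_one.mpr hq1 |>.trans_eq' rfl
  set x : ℝ := 1 / (2 * d + 1) with hx
  have hx0 : 0 ≤ x := by positivity
  have hqx : q * x = y⁻¹ := by rw [hq, hx]; field_simp
  -- termwise bound
  have hterm : ∀ ω ∈ irreducibleBridges (d + 1) i,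
      y ^ (ω i 0).toNat ≤ y ^ i * Real.sqrt q ^ (i - 1) * x ^ ((i : ℤ) - ω i 0).toNat := by
    intro ω hω
    have hsc := span_le_and_cost_bound_zd hω
    rw [← costZd_eq_toNat_sub hω]
    set c := costZd d i ω with hc
    have hci : c ≤ i := by rw [hc, costZd]; exact Nat.sub_le _ _
    have hspan : (ω i 0).toNat = i - c := by rw [hc, costZd]; omega
    have h2c : i - 1 ≤ 2 * c := by omega
    have hyc : y ^ (ω i 0).toNat = y ^ i * (y⁻¹) ^ c := by
      rw [hspan, inv_pow, ← div_eq_mul_inv, eq_div_iff (pow_ne_zero _ hy0.ne'), ← pow_add, Nat.sub_add_cancel (by omega)]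
    rw [hyc, ← hqx, mul_pow, ← mul_assoc]
    refine mul_le_mul_of_nonneg_right (mul_le_mul_of_nonneg_left ?_ (by positivity)) (by positivity)
    calc q ^ c = Real.sqrt q ^ (2 * c) := by rw [pow_mul, Real.sq_sqrt hq0]
      _ ≤ Real.sqrt q ^ (i - 1) := pow_le_pow_of_le_one hs0 hs1 h2c
  have hsub : irreducibleBridges (d + 1) i ⊆ saws (d + 1) i := fun ω hω =>
    (mem_bridges.1 (mem_irreducibleBridges.1 hω).1).1
  have hP : (1 + 2 * (d : ℝ) * x + x ^ 2) ≤ 2 := one_add_poly_at_inv_le_two d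
  unfold pulledIrrZ
  calc ∑ ω ∈ irreducibleBridges (d + 1) i, y ^ (ω i 0).toNat
      ≤ ∑ ω ∈ irreducibleBridges (d + 1) i, y ^ i * Real.sqrt q ^ (i - 1) * x ^ ((i : ℤ) - ω i 0).toNat :=
        Finset.sum_le_sum hterm
    _ = y ^ i * Real.sqrt q ^ (i - 1) * ∑ ω ∈ irreducibleBridges (d + 1) i, x ^ ((i : ℤ) - ω i 0).toNat := by
        rw [Finset.mul_sum]
    _ ≤ y ^ i * Real.sqrt q ^ (i - 1) * ∑ ω ∈ saws (d + 1) i, x ^ ((i : ℤ) - ω i 0).toNat :=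
        mul_le_mul_of_nonneg_left (Finset.sum_le_sum_of_subset_of_nonneg hsub fun ω _ _ => by positivity) (by positivity)
    _ ≤ y ^ i * Real.sqrt q ^ (i - 1) * (1 + 2 * d * x + x ^ 2) ^ i :=
        mul_le_mul_of_nonneg_left (sum_saws_pow_deficit_le d hx0 i) (by positivity)
    _ ≤ y ^ i * Real.sqrt q ^ (i - 1) * 2 ^ i :=
        mul_le_mul_of_nonneg_left (pow_le_pow_left₀ (by positivity) hP i) (by positivity)

/-- ★ **LINEAR geometric envelope of the block law on `ℤ^{d+1}`**: for `y ≥ 2d + 1` and every `i`,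
`p_i(y) ≤ √(y/(2d+1)) · (2√((2d+1)/y))^i` (`p_i = Λ_i e^{-iλ_B} ≤ Λ_i y^{-i}`). The ratio is `< 1` as soon as `y > 4(2d+1)`.
[cite: MadrasSlade1993, §4.2, (4.2.21)–(4.2.22) (p. 94, 2013 reprint)] [cite: Beaton2015, §3, Lemma 2] -/
theorem pulledBlockLaw_le_geometric_linear (d : ℕ) {y : ℝ} (hy : (2 * d + 1 : ℝ) ≤ y) (i : ℕ) :
    pulledBlockLaw (d + 1) y i ≤ (Real.sqrt ((2 * d + 1) / y))⁻¹ * (2 * Real.sqrt ((2 * d + 1) / y)) ^ i := by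
  have hD : (0 : ℝ) < 2 * d + 1 := by positivity
  have hy0 : 0 < y := hD.trans_le hy
  have hs : 0 < Real.sqrt ((2 * d + 1) / y) := Real.sqrt_pos.2 (by positivity)
  rcases Nat.eq_zero_or_pos i with rfl | hi
  · rw [pulledBlockLaw_zero]; positivity
  have hΛ := pulledIrrZ_le_linear d hi hy
  have hE := exp_neg_mul_pulledBridgeFreeEnergy_le_zd d hy0 i
  unfold pulledBlockLaw
  calc pulledIrrZ (d + 1) i y * Real.exp (-(i : ℝ) * pulledBridgeFreeEnergy (d + 1) y)
      ≤ (y ^ i * Real.sqrt ((2 * d + 1) / y) ^ (i - 1) * 2 ^ i) * (y ^ i)⁻¹ :=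
        mul_le_mul hΛ hE (Real.exp_pos _).le (by positivity)
    _ = (Real.sqrt ((2 * d + 1) / y))⁻¹ * (2 * Real.sqrt ((2 * d + 1) / y)) ^ i := by
        have : Real.sqrt ((2 * d + 1) / y) ^ i = Real.sqrt ((2 * d + 1) / y) ^ (i - 1) * Real.sqrt ((2 * d + 1) / y) := by
          rw [← pow_succ, Nat.sub_add_cancel hi]
        rw [mul_pow, this]; field_simp

/-- For `y > 4(2d+1)` the linear envelope ratio `2√((2d+1)/y)` is `< 1` (and `> 0`). [cite: MadrasSlade1993, §4.2, (4.2.22)] -/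
theorem envelopeRatio_linear_lt_one (d : ℕ) {y : ℝ} (hy : 4 * (2 * d + 1 : ℝ) < y) :
    0 < 2 * Real.sqrt ((2 * d + 1) / y) ∧ 2 * Real.sqrt ((2 * d + 1) / y) < 1 := by
  have hD : (0 : ℝ) < 2 * d + 1 := by positivity
  have hy0 : 0 < y := by linarith
  refine ⟨by positivity, ?_⟩
  have hq : (2 * d + 1) / y < (1 / 2) ^ 2 := by rw [div_lt_iff₀ hy0]; nlinarith
  have := (Real.sqrt_lt' (by norm_num : (0 : ℝ) < 1 / 2)).2 hq
  linarith

/-- ★★ **The renewal gap on `ℤ^{d+1}` for every `y > 4(2d+1)`, every dimension**: the pulled Kesten relation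
`Σ_i Λ_i(y) e^{-iλ_B(y)} = 1`, a finite mean block length, the all-`n` sandwich and the renewal limit — the regime of
`pulledGap_zd` (`y > μ³ ≈ (2d+1)³`) lowered to a LINEAR threshold by the linear envelope.
[cite: Beaton2015, Lemma 2; MadrasSlade1993, Theorem 4.2.2 (b)] -/
theorem pulledGap_linear (d : ℕ) {y : ℝ} (hy : 4 * (2 * d + 1 : ℝ) < y) :
    HasSum (pulledBlockLaw (d + 1) y) 1 ∧ (Summable fun i : ℕ => (i : ℝ) * pulledBlockLaw (d + 1) y i)
    ∧ (∀ n : ℕ, 2 - pulledMeanBlock (d + 1) y ≤ pulledAmp (d + 1) y n ∧ pulledAmp (d + 1) y n ≤ 1)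
    ∧ Tendsto (pulledAmp (d + 1) y) atTop (𝓝 (pulledMeanBlock (d + 1) y)⁻¹) := by
  have h21 : (0 : ℝ) ≤ 2 * d + 1 := by positivity
  have hy1 : (2 * d + 1 : ℝ) ≤ y := by linarith
  have hy0 : 0 < y := by linarith
  obtain ⟨hr0, hr1⟩ := envelopeRatio_linear_lt_one d hy
  have henv := pulledBlockLaw_le_geometric_linear d hy1
  have hK : HasSum (pulledBlockLaw (d + 1) y) 1 :=
    Literature.Probability.Process.Renewal.hasSum_f_one_of_envelope (pulledAmp_zero d y)
      (pulledAmp_nonneg d hy0) (pulledAmp_le_one d hy0) (pulledBlockLaw_nonneg hy0.le) (pulledBlockLaw_zero y)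
      (fun n hn => pulledAmp_renewal d y n hn) hr0 hr1 henv (fun s hs M => pulledAmp_mul_pow_unbounded d hy0 hs M)
  have hM : Summable fun i : ℕ => (i : ℝ) * pulledBlockLaw (d + 1) y i :=
    Literature.Probability.Process.Renewal.summable_mul_f_of_envelope (pulledBlockLaw_nonneg hy0.le) hr0 hr1 henv
  exact ⟨hK, hM, two_sub_pulledMeanBlock_le_pulledAmp_of d hy0 hK hM, tendsto_pulledAmp_of d hy0 hK hM⟩

/-- ★ **Kesten's equation in the expansion variables on `ℤ^{d+1}` for every `y > 4(2d+1)`**: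
`Σ_c y^{-c} P_c(u(y)) = 1`, `P_c(u) = Σ_n N_{c,n} uⁿ`, `u = y e^{-λ_B(y)}`.
[cite: Beaton2015, Lemma 2; MadrasSlade1993, §4.2, eq. (4.2.15)–(4.2.16) (p. 93, 2013 reprint)] -/
theorem hasSum_costPoly_linear (d : ℕ) {y : ℝ} (hy : 4 * (2 * d + 1 : ℝ) < y) :
    HasSum (fun c : ℕ => (∑ n ∈ Finset.range (2 * c + 2), (costCoeffZd d c n : ℝ) * largeForceUZd d y ^ n) / y ^ c) 1 := by
  have h21 : (0 : ℝ) ≤ 2 * d + 1 := by positivity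
  have hy0 : 0 < y := by linarith
  set u := largeForceUZd d y with hu
  have hu0 : 0 ≤ u := (largeForceUZd_pos d hy0).le
  set F : ℕ × ℕ → ℝ := fun p => (costCoeffZd d p.2 p.1 : ℝ) * u ^ p.1 / y ^ p.2 with hF
  have hF0 : ∀ p, 0 ≤ F p := fun p => by positivity
  have hrow : ∀ i, HasSum (fun c => F (i, c)) (pulledBlockLaw (d + 1) y i) := by
    intro i
    rw [pulledBlockLaw_eq_sum_costCoeffZd d hy0 i]
    refine hasSum_sum_of_ne_finset_zero fun c hc => ?_
    have hc' : i < c := by simpa [Finset.mem_range, Nat.lt_succ_iff] using hc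
    simp [hF, costCoeffZd_eq_zero_of_lt' hc']
  have hK := (pulledGap_linear d hy).1
  have hsum : Summable F := by
    refine (summable_prod_of_nonneg hF0).2 ⟨fun i => (hrow i).summable, ?_⟩
    simpa [fun i => (hrow i).tsum_eq] using hK.summable
  have hF1 : HasSum F 1 := by
    have h := hsum.hasSum
    have h' : HasSum (pulledBlockLaw (d + 1) y) (∑' p, F p) := h.prod_fiberwise hrow
    rwa [h'.unique hK] at h
  have hG : HasSum (fun q : ℕ × ℕ => F (q.2, q.1)) 1 := (Equiv.prodComm ℕ ℕ).hasSum_iff.2 hF1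
  refine hG.prod_fiberwise fun c => ?_
  rw [Finset.sum_div]
  refine hasSum_sum_of_ne_finset_zero fun i hi => ?_
  have hi' : 2 * c + 2 ≤ i := by simpa [Finset.mem_range] using hi
  simp [hF, costCoeffZd_eq_zero_of_lt (show 3 * c + 2 < 2 * i by omega)]

/-- Kesten's equation in `t = 1/y` on `ℤ^{d+1}` for `0 < t ≤ 1/(8000(2d+1))` (any `t < 1/(4(2d+1))` would do).
[cite: Beaton2015, Lemma 2] -/
theorem hasSum_costPoly_inv_linear (d : ℕ) {t : ℝ} (ht : t ∈ Set.Ioc (0 : ℝ) (1 / (8000 * (2 * (d : ℝ) + 1)))) :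
    HasSum (fun c => t ^ c * CostSeries.P (costCoeffZd d) c (largeForceUZd d t⁻¹)) 1 := by
  have hD : (0 : ℝ) < 2 * d + 1 := by positivity
  have hy : 4 * (2 * d + 1 : ℝ) < t⁻¹ := by
    have h1 : t ≤ 1 / (8000 * (2 * (d : ℝ) + 1)) := ht.2
    rw [lt_inv_comm₀ (by positivity) ht.1]
    calc t ≤ 1 / (8000 * (2 * (d : ℝ) + 1)) := h1
      _ < (4 * (2 * (d : ℝ) + 1))⁻¹ := by rw [one_div, inv_lt_inv₀ (by positivity) (by positivity)]; nlinarith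
  have h := hasSum_costPoly_linear d hy
  refine h.congr_fun fun c => ?_
  rw [CostSeries.P, inv_pow, div_inv_eq_mul, mul_comm]

/-- ★★★ **THE LARGE-FORCE EXPANSION ON `ℤ^{d+1}` CONVERGES FOR EVERY `y ≥ 8000(2d+1)`, EVERY DIMENSION**:
`e^{λ_B(y)} = Σ_{k=0}^{∞} c_k^{(d)} y^{1−k}` (`HasSum`).  The radius of convergence in `1/y` is thus at least `1/(8000(2d+1))`,
LINEAR in `1/d` (the tree's `hasSum_largeForceCoeffZd` needs `y ≥ 1/t*_d` with `1/t*_d` of order `d³`).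
[cite: JansevanRensburgWhittington2013, §3.2 Theorem 8 (arXiv v4 p. 11)] [cite: Beaton2015, Lemma 2] -/
theorem hasSum_largeForceCoeffZd_linear (d : ℕ) {y : ℝ} (hy : 8000 * (2 * d + 1 : ℝ) ≤ y) :
    HasSum (fun k => y * ((largeForceCoeffZd d k : ℝ) * y⁻¹ ^ k)) (Real.exp (pulledBridgeFreeEnergy (d + 1) y)) := by
  have hD : (0 : ℝ) < 2 * d + 1 := by positivity
  have hy0 : 0 < y := lt_of_lt_of_le (by positivity) hy
  have ht0 : y⁻¹ ∈ Set.Ioc (0 : ℝ) (1 / (8000 * (2 * (d : ℝ) + 1))) :=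
    ⟨inv_pos.2 hy0, by rw [one_div, inv_le_inv₀ hy0 (by positivity)]; exact hy⟩
  have ht : y⁻¹ ∈ Set.Ioc (0 : ℝ) (min (1 / (8000 * (2 * (d : ℝ) + 1))) (1 / (400 * (4 * (2 * (d : ℝ) + 1)) * (4 + 1)))) := by
    rw [show (400 : ℝ) * (4 * (2 * d + 1)) * (4 + 1) = 8000 * (2 * d + 1) by ring, min_self]; exact ht0
  have h := CostSeries.hasSum_e_inv (costCoeffZd d) (B := 4) (ρ := 4 * (2 * d + 1)) (t₀ := 1 / (8000 * (2 * (d : ℝ) + 1)))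
    (u := fun t => largeForceUZd d t⁻¹) (by norm_num) (by positivity) (sum_costCoeffZd_le_linear d) (P_costCoeffZd_zero d)
    (fun t ht' => ⟨(largeForceUZd_pos d (inv_pos.2 ht'.1)).le, largeForceUZd_le_one d (inv_pos.2 ht'.1)⟩)
    (fun t ht' => hasSum_costPoly_inv_linear d ht') ht
  have h2 := h.mul_left y
  simp only [inv_inv] at h2
  rw [exp_pulledBridgeFreeEnergy_eq_div_zd d hy0, div_eq_mul_inv]
  exact h2

/-- The same in `tsum` form: for `y ≥ 8000(2d+1)`, `e^{λ_B(y)} = Σ' k, c_k^{(d)} y^{1-k}` and the series is summable.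
[cite: JansevanRensburgWhittington2013, §3.2 Theorem 8 (arXiv v4 p. 11)] -/
theorem exp_pulledBridgeFreeEnergy_eq_tsum_linear (d : ℕ) {y : ℝ} (hy : 8000 * (2 * d + 1 : ℝ) ≤ y) :
    (Summable fun k => y * ((largeForceCoeffZd d k : ℝ) * y⁻¹ ^ k)) ∧
      Real.exp (pulledBridgeFreeEnergy (d + 1) y) = ∑' k, y * ((largeForceCoeffZd d k : ℝ) * y⁻¹ ^ k) :=
  ⟨(hasSum_largeForceCoeffZd_linear d hy).summable, (hasSum_largeForceCoeffZd_linear d hy).tsum_eq.symm⟩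

/-- ★★ **Explicit uniform remainder**: for `y ≥ 8000(2d+1)` and every `K`,
`|e^{λ_B(y)} − Σ_{k ≤ K} c_k^{(d)} y^{1-k}| ≤ 4y · (960(2d+1)/y)^{K+1}` on `ℤ^{d+1}` (tail of the convergent series with
`|c_k^{(d)}| ≤ 3·(960(2d+1))^k` and ratio `960(2d+1)/y ≤ 3/25`). [cite: JansevanRensburgWhittington2013, §3.2 Theorem 8 (arXiv v4 p. 11)] -/
theorem abs_exp_pulledBridgeFreeEnergy_sub_sum_le_linear (d K : ℕ) {y : ℝ} (hy : 8000 * (2 * d + 1 : ℝ) ≤ y) :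
    |Real.exp (pulledBridgeFreeEnergy (d + 1) y) -
        ∑ k ∈ Finset.range (K + 1), y * ((largeForceCoeffZd d k : ℝ) * y⁻¹ ^ k)|
      ≤ 4 * y * (960 * (2 * d + 1) / y) ^ (K + 1) := by
  have hD : (0 : ℝ) < 2 * d + 1 := by positivity
  have hy0 : 0 < y := lt_of_lt_of_le (by positivity) hy
  set ρ : ℝ := 960 * (2 * d + 1) / y with hρ
  have hρ0 : 0 ≤ ρ := by positivity
  have hρ1 : ρ ≤ 3 / 25 := by
    rw [hρ, div_le_iff₀ hy0]; nlinarith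
  have hS := hasSum_largeForceCoeffZd_linear d hy
  set f : ℕ → ℝ := fun k => y * ((largeForceCoeffZd d k : ℝ) * y⁻¹ ^ k) with hf
  have htail : HasSum (fun k => f (k + (K + 1))) (Real.exp (pulledBridgeFreeEnergy (d + 1) y) - ∑ k ∈ Finset.range (K + 1), f k) :=
    (hasSum_nat_add_iff' (K + 1)).2 hS
  -- geometric majorant of the tail
  set A : ℝ := 960 * (2 * d + 1) with hA
  have hmaj : ∀ k, |f (k + (K + 1))| ≤ 3 * y * ρ ^ (K + 1) * ρ ^ k := by
    intro k
    have hc := abs_largeForceCoeffZd_le_linear' d (k + (K + 1))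
    rw [← hA] at hc
    rw [hf]
    dsimp only
    rw [abs_mul, abs_of_pos hy0, abs_mul, abs_pow, abs_inv, abs_of_pos hy0]
    calc y * (|((largeForceCoeffZd d (k + (K + 1)) : ℤ) : ℝ)| * y⁻¹ ^ (k + (K + 1)))
        ≤ y * (3 * A ^ (k + (K + 1)) * y⁻¹ ^ (k + (K + 1))) :=
          mul_le_mul_of_nonneg_left (mul_le_mul_of_nonneg_right hc (by positivity)) hy0.le
      _ = 3 * y * ρ ^ (K + 1) * ρ ^ k := by
          rw [hρ, div_eq_mul_inv, mul_pow A y⁻¹ (K + 1), mul_pow A y⁻¹ k]; ring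
  have hgeo : HasSum (fun k => 3 * y * ρ ^ (K + 1) * ρ ^ k) (3 * y * ρ ^ (K + 1) * (1 - ρ)⁻¹) :=
    (hasSum_geometric_of_lt_one hρ0 (by linarith)).mul_left _
  have habs : Summable fun k => |f (k + (K + 1))| := hgeo.summable.of_nonneg_of_le (fun k => abs_nonneg _) hmaj
  have h1 : |Real.exp (pulledBridgeFreeEnergy (d + 1) y) - ∑ k ∈ Finset.range (K + 1), f k| ≤
      3 * y * ρ ^ (K + 1) * (1 - ρ)⁻¹ := by
    rw [← htail.tsum_eq, ← hgeo.tsum_eq]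
    calc |∑' k, f (k + (K + 1))| ≤ ∑' k, |f (k + (K + 1))| := by
          have := norm_tsum_le_tsum_norm (f := fun k => f (k + (K + 1))) (by simpa [Real.norm_eq_abs] using habs)
          simpa [Real.norm_eq_abs] using this
      _ ≤ ∑' k, 3 * y * ρ ^ (K + 1) * ρ ^ k := habs.tsum_le_tsum hmaj hgeo.summable
  calc |Real.exp (pulledBridgeFreeEnergy (d + 1) y) - ∑ k ∈ Finset.range (K + 1), f k|
      ≤ 3 * y * ρ ^ (K + 1) * (1 - ρ)⁻¹ := h1
    _ ≤ 3 * y * ρ ^ (K + 1) * (4 / 3) := by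
        refine mul_le_mul_of_nonneg_left ?_ (by positivity)
        rw [inv_le_comm₀ (by linarith) (by norm_num)]; linarith
    _ = 4 * y * ρ ^ (K + 1) := by ring

end Literature.Probability.RandomPlanarGeometry.SAW.Zd
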